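/-
Copyright (c) 2026 the pub-hodgecm-mathlib formalisation cell (harness21).  Prover seat hodgecm-mathlib-B-p14 (g43): «NORM LADDER for `K(√d)∕K` WILD, define-free»
(F0P3a-p06 (g18) deal (3) 10:12:43Z BY NAME; LH4-plan (g5) wild base-layer seam; census F0P3a-p06 (g17) `DUNR-H2-CENSUS.md` §3, mechanisms M4∕M6); 2026-09-02.
-/
import Literature.NumberTheory.LocalFields.WildQuadraticNormGroupAPI   -- ★ the whole wild quadratic layer (Hensel kernel, Brahmagupta, (C4), conductor API)
import HarnessLib

/-!
# Wild quadratic norms — the NORM LADDER `N(U_{K(√d)}^{(2n − f + 1)}) = U_K^{(n)}` for `n ≥ f`, define-free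
# (Serre, *Local Fields* V §3 Prop. 5 (iii) ∕ Cor. 3 for the totally ramified quadratic extension `K(√d)∕K`, `ψ(n) = 2n − f + 1`)

Topic `NumberTheory/LocalFields`; namespace `Literature.NumberTheory.LocalFields`.  THEOREMS ONLY (no definition, no instance, no notation, no named fact, no `sorry`);
CM-free; kernel lane `--supports stmt-HodgeConjecture-24833`.  Cell `pub/hodgecm-mathlib` (D-0151), crux H413 = `stmt-HodgeConjecture-24833`; half A line LH4, DYADIC
pay-down leaf `Cruxes/H413/Lines/F0_P3c_DyadicPaydown.lean`, organs (D-UNR)∕(D-RAM) (PRINT by D74′, SCOPE-AUDIT b4c76626 COVERED; census F0P3a-p06 (g17) OUTCOME B: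
the self-dual lattice laws (M4) and the Euler–Poincaré relation (M6) on the wild type-(2) tori key on the conductor `f` AND on the norm groups of the unit
filtration).  Tenth file of the wild quadratic layer ★ `WildQuadraticNormsNearOne` · `…Exactness` · `…Descent` · `…IndexTwo` · `…UnitConductor` · `…UnitIndexTwo` ·
`…IndexTwoAll` · `WildQuadraticNormGroupAPI` · `WildQuadraticNormsCMBridge`.  It is the DEFINE-FREE TWIN of ★ `Automorphic/RamifiedPlaceLevelNorms` (LH4-p03 (g5), p850931:
the same ladder at a ramified CM place `L_w ∕ L⁺_v`, in `σ_w`-currency, `ψ(n) = 2n − d + 1` with `d` the different number); here no extension field is built and `f` is the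
layer's norm conductor of ★ `conductor_exists_of_forall_mul_self_ne` (value table `2e + 1` ∕ `2e + 1 − s`), so the two files are disjoint in currency and cross-citable
(`f` there = `d` there = `t + 1` here).  HONEST LABEL: HC_CM is proved only modulo the 7 printed citations (2 remaining named inputs: hLiu418 = stmt-HodgeConjecture-24832,
h413 = stmt-HodgeConjecture-24833) until rung 0 closes; count-neutral, Mathlib-footed, bankable base layer.

DICTIONARY (LH4-plan (g5) WORD #8).  `f` here = the layer's norm conductor of ★ (ii) `conductor_exists_of_forall_mul_self_ne` (`LocalFields/WildQuadraticNormGroupAPI`)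
= the `d` of ★ p850931 `Automorphic/RamifiedPlaceLevelNorms` (LH4-p03 (g5)) = the different exponent `d` of ★ p850893 `Automorphic/RamifiedPlaceDifferentConductor`
(`exists_different_eq_conductor_of_ramified`, F0P3a-p06 (g18)): ONE theorem (Serre V §3 Cor. 3) in two disjoint currencies — define-free `K(√d)` here (no extension field,
no `σ`; `f = t + 1` enters through `ht : v 4 · exp t = v(1 − d)`) vs the CM place `L_w ∕ L⁺_v` in `adicCompletion`∕`σ_w`-currency there.  SCOPE: §1–§3 carry no
residue-characteristic hypothesis; `normLadder_of_valued_odd` at `e = 0` (`v 2 = 1`) IS the tame ladder `N(U_E^{(2n)}) = U^{(n)}` (`f = 1`, the `hnorm` clause of ★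
`ramifiedBlock_adicCompletion` ∕ ★ p850931 at `d = 1`), while the odd-defect class `v 4 < v(d − 1) < 1` exists only when `v 2 < 1` (wild); the dyadic consumer reads both
at `v 2 = exp(−e)`, `e ≥ 1`.

CURRENCY (define-free, as the layer).  `Valued.v : K → ℤᵐ⁰`, `[IsAdicComplete 𝓂[K] 𝒪[K]]`; «`x ∈ N_d`» := `∃ a b, a·a − d·(b·b) = x` (the norm of `z = a + b√d`).
ONE new letter, the UPPER FILTRATION read through the norm: when `K(√d)∕K` is totally ramified the valuation of `K(√d)` is `v_E = v_K ∘ N` (both value groups `ℤ`), so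
«`z = a + b√d ∈ U_E^{(m)}`», i.e. `v_E(z − 1) ≥ m` with `z − 1 = (a − 1) + b√d`, is the define-free clause **`Valued.v ((a − 1)·(a − 1) − d·(b·b)) ≤ exp(−m)`** — the DEPTH of
the representation `(a, b)`.  The break is `t = f − 1` and `ψ(n) = t + 2(n − t) = 2n − t = 2n − f + 1` for `n ≥ t` (Serre V §3).  The parameter `t` enters every
general statement through ONE hypothesis **`ht : v 4 · exp t = v (1 − d)`** (`t = 2e − s`, `s = ord(d − 1)` on the layer's normal forms: `s = 0` for odd order, `s` odd
`< 2e` for a unit of odd defect), and the normal forms discharge it (§4).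

* §0 `le_exp_neg_of_sq_le_exp_neg` — integer rounding in `ℤᵐ⁰`: `x² ≤ exp(−j)`, `2k ≤ j + 1` ⇒ `x ≤ exp(−k)` (the «`⌈j∕2⌉`» of Serre's `⌊(m + d)∕2⌋`).
* §1 **THE UNIVERSAL WITNESS** `exists_sq_sub_mul_sq_eq_of_valued_mul_one_sub_lt_four`: for ANY `d ≠ 1` and `x` with `v((x − 1)(1 − d)) < v 4` there are `a b` with
  `a·a − d·(b·b) = x` AND `v((a−1)·(a−1) − d·(b·b)) · v 4 = v(x − 1)² · v(1 − d)` — EXACT depth.  Proof: `z := 1 + 2μ∕(1 + √d)`, i.e. `a = 1 + 2μ∕(1 − d)`, `b = −2μ∕(1 − d)`,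
  where `μ·μ + μ = (x − 1)(1 − d)∕4` is the Hensel kernel ★ `exists_valued_lt_one_mul_self_add_mul_eq` (`b = 1`): then `N z = 1 + 4(μ² + μ)∕(1 − d) = x` and
  `N(z − 1) = 4μ²∕(1 − d)`, `v μ = v((x − 1)(1 − d)∕4)`.  No normal form, no case split — the norm IS the trace at these depths.
* §2 **THE TRACE BOUND** (Serre III §3 Prop. 7 `Tr 𝔭_E^m ⊆ 𝔭_K^{⌊(m + f)∕2⌋}` read define-free; `Tr(α + β√d) = 2α`): `v(α·α·(1 − d)) ≤ v(α·α − d·(β·β))` on the two normal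
  forms — `valued_mul_self_mul_one_sub_le_of_valued_lt_one` (ODD ORDER `v d < 1`, `v d` not a square value: the two terms never tie) and `…_of_odd_defect` (`v 4 < v(d − 1) ≤ 1`,
  `v(d − 1)` not a square value: `α² − dβ² = (α − β)(α + β) − (d − 1)β²` and `v((α − β)(α + β)) ≠ v((d − 1)β²)` by the three-way comparison of `v(2β)` with `v(α − β)`).
* §3 **THE LADDER, general `t`** (hypotheses `ht` and, for the inclusions, the trace bound `hTB` as a ∀-clause): (L1) `exists_sq_sub_mul_sq_eq_of_valued_sub_one_le_exp_neg` —
  `t + 1 ≤ n`, `v(x − 1) ≤ exp(−n)` ⇒ `∃ a b, N = x ∧ depth = v(x − 1)²·exp t ≤ exp(−(2n − t))` (`U^{(n)} ⊆ N(U_E^{(ψ(n))})`); (L2∕L3) `valued_sq_sub_mul_sq_sub_one_le_exp_neg` —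
  `depth ≤ exp(−m)`, `n ≤ m`, `2n ≤ m + t + 1` ⇒ `v(N − 1) ≤ exp(−n)`: with `m = 2n − t` this is `N(U_E^{(ψ(n))}) ⊆ U^{(n)}`, with `m = 2n − t + 1` and `n + 1` it is the SHARPNESS
  `N(U_E^{(ψ(n)+1)}) ⊆ U^{(n+1)}` (Serre's second clause) — norms climb exactly along `ψ`.
* §4 **NORMAL FORMS** (the layer's two ramified classes, ★ (C4) `exists_unit_mul_sq_depth_dichotomy`): `normLadder_of_valued_odd` (`v 2 = exp(−e)`, `v d < 1` odd: `t = 2e`,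
  `f = 2e + 1`, `ψ(n) = 2n − 2e`, = ★ `conductor_of_valued_odd`'s `f`) and `normLadder_of_odd_defect` (`v(d − 1) = exp(−s)`, `v 4 < v(d − 1)`, `s` odd: `t = 2e − s`, `f = 2e + 1 − s`,
  `ψ(n) = 2n − 2e + s`, = ★ `conductor_one_add_of_odd_defect`'s `f`): each the conjunction (L1) ∧ (L2) ∧ (L3) for `n ≥ f`.
SEQUEL (consumer file `WildQuadraticNormLadderAPI`): the EXACT-RUNG witness (`x = 1 + ϖⁿ` is a norm from depth `ψ(n)` and from no representation of depth `≥ ψ(n) + 1`), the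
SQUARE-CLASS TRANSPORT of the depth letter (`(d, b) ↦ (d·c², b∕c)` fixes norm and depth, so any ramified `d` reaches §4 via ★ (C4)), and the `∃ f`-packaged «every ramified
non-square `d`» dress with `f` pinned as the conductor of ★ (ii).
NOT HERE (honest scope): the graded map at the break `n = t` (`ξ ↦ ξ² + ᾱξ`, index-2 image — that is the conductor theorem ★ (ii), not a ladder rung); the unramified class
(`f = 0`, where `v_E = v_K ∘ N ∕ 2` and the ladder is `N(U_E^{(n)}) = U^{(n)}`, all `n ≥ 0`).

## References
* [Serre1979] J.-P. Serre, *Local Fields*, GTM 67 (1979): Ch. V §3 Prop. 5 (iii) & Cor. 3 (`N(U_L^{ψ(n)}) = U_K^n`, `N(U_L^{ψ(n)+1}) = U_K^{n+1}` for `n > t`, cyclic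
  totally ramified of prime degree `ℓ`; `ψ(n) = t + ℓ(n − t)`), Ch. III §3 Prop. 7 (`Tr 𝔭_L^m = 𝔭_K^{⌊(m+d)∕e⌋}`), Ch. IV §1–§2 (`t + 1 = d = f` for `ℓ = 2`),
  Ch. XV §2 (conductor via `U_K^{(n)}`), Ch. II §4 Prop. 7 (Hensel).
* [NeukirchANT1999] J. Neukirch, *Algebraic Number Theory* (1999): Ch. V (1.2)–(1.3) (norm groups of the higher unit groups), Ch. II (4.6) (Hensel).
* [Omeara1963] O. T. O'Meara, *Introduction to Quadratic Forms*, Grundlehren 117 (1963), §63A 63:2–63:5 (normal forms of dyadic square classes), §63B 63:11a.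
-/

set_option autoImplicit false

noncomputable section

open scoped Valued WithZero
open WithZero

namespace Literature.NumberTheory.LocalFields

/-! ## §0 Integer rounding in `ℤᵐ⁰` -/
section Rounding

/-- **ROUNDING**: in `ℤᵐ⁰`, if `x² ≤ exp(−j)` and `2k ≤ j + 1` then `x ≤ exp(−k)` — `x = exp(m)` with `2m ≤ −j` forces `m ≤ −⌈j∕2⌉`.  (Serre's `⌊(m + d)∕2⌋` in
`Tr 𝔭_L^m = 𝔭_K^{⌊(m+d)∕2⌋}` is this rounding.) [cite: Serre1979, Ch. III §3 Prop. 7] -/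
theorem le_exp_neg_of_sq_le_exp_neg {x : ℤᵐ⁰} {j k : ℤ} (h : x ^ 2 ≤ exp (-j)) (hk : 2 * k ≤ j + 1) : x ≤ exp (-k) := by
  by_cases hx : x = 0
  · rw [hx]
    exact zero_le
  · rw [← exp_log hx] at h ⊢
    rw [pow_two, ← exp_add, exp_le_exp] at h
    rw [exp_le_exp]
    omega

end Rounding

section Ladder
variable {K : Type*} [Field K] [Valued K ℤᵐ⁰]

/-! ## §1 The universal witness `z = 1 + 2μ ∕ (1 + √d)` -/

/-- **THE UNIVERSAL WITNESS (norm = trace at depth beyond the break).**  `K` with `𝓂[K]`-adically complete valuation ring; `d ≠ 1`; `x` with `v((x − 1)·(1 − d)) < v 4`.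
Then `x = a·a − d·(b·b)` for some `a b` whose DEPTH is EXACTLY `v((a − 1)·(a − 1) − d·(b·b)) = v(x − 1)²·v(1 − d) ∕ v 4`.  Witness: the Hensel kernel
(★ `exists_valued_lt_one_mul_self_add_mul_eq`, `b = 1`) solves `μ·μ + μ = (x − 1)(1 − d)∕4` with `v μ < 1` (hence `v μ = v((x − 1)(1 − d)∕4)`), and
`a := 1 + 2μ∕(1 − d)`, `b := −2μ∕(1 − d)` — i.e. `z = 1 + 2μ∕(1 + √d)`: `N z = 1 + 4(μ² + μ)∕(1 − d) = x`, `N(z − 1) = 4μ²∕(1 − d)`.  No hypothesis on `d` beyond `d ≠ 1`,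
no residue-characteristic hypothesis. [cite: Serre1979, Ch. V §3 Prop. 5 (iii)] [cite: Serre1979, Ch. II §4 Prop. 7] [cite: NeukirchANT1999, Ch. II (4.6)] -/
theorem exists_sq_sub_mul_sq_eq_of_valued_mul_one_sub_lt_four [IsAdicComplete 𝓂[K] 𝒪[K]] {d : K} (hd1 : d ≠ 1) {x : K}
    (hx : Valued.v ((x - 1) * (1 - d)) < Valued.v (4 : K)) :
    ∃ a b : K, a * a - d * (b * b) = x ∧
      Valued.v ((a - 1) * (a - 1) - d * (b * b)) * Valued.v (4 : K) = Valued.v (x - 1) ^ 2 * Valued.v (1 - d) := by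
  have hv40 : Valued.v (4 : K) ≠ 0 := by
    intro h
    rw [h] at hx
    exact not_lt_zero hx
  have h40 : (4 : K) ≠ 0 := (Valuation.ne_zero_iff _).1 hv40
  have h1d : (1 - d) ≠ 0 := sub_ne_zero.2 (Ne.symm hd1)
  have hv1d : Valued.v (1 - d) ≠ 0 := (Valuation.ne_zero_iff _).2 h1d
  -- the Hensel kernel `μ·μ + μ = C`, `C := (x − 1)(1 − d)∕4`, `v C < 1`
  set C : K := (x - 1) * (1 - d) / 4 with hC
  have hvC : Valued.v C < 1 := by
    rw [hC, map_div₀, div_lt_one₀ (zero_lt_iff.2 hv40)]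
    exact hx
  obtain ⟨μ, hμ1, hμ⟩ := exists_valued_lt_one_mul_self_add_mul_eq (b := 1) (c := C) (map_one _) hvC
  have hμC : μ * μ + μ = C := by linear_combination hμ
  have hvμ : Valued.v μ = Valued.v C := by
    have h1μ : Valued.v (1 + μ) = 1 := Valuation.map_one_add_of_lt _ hμ1
    rw [← hμC, show μ * μ + μ = μ * (1 + μ) by ring, map_mul, h1μ, mul_one]
  have hkey : 4 * (μ * μ + μ) = (x - 1) * (1 - d) := by
    rw [hμC, hC]
    field_simp
  refine ⟨1 + 2 * μ / (1 - d), -(2 * μ / (1 - d)), ?_, ?_⟩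
  · -- `N z = x`
    field_simp
    linear_combination (1 - d) * hkey
  · -- the depth `N(z − 1) = 4μ²∕(1 − d)`, `v μ = v C`
    have hdepth : (1 + 2 * μ / (1 - d) - 1) * (1 + 2 * μ / (1 - d) - 1) - d * (-(2 * μ / (1 - d)) * -(2 * μ / (1 - d))) =
        4 * (μ * μ) / (1 - d) := by
      field_simp
      ring
    rw [hdepth, map_div₀, map_mul, map_mul, hvμ, hC, map_div₀, map_mul]
    field_simp

/-! ## §2 The trace bound `v(α·α·(1 − d)) ≤ v(α·α − d·(β·β))` on the two ramified normal forms -/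

/-- **TRACE BOUND, ODD ORDER.**  If `v d < 1` and `v d` is not a square value (`ord d` odd), then for all `α β`: `v(α·α·(1 − d)) ≤ v(α·α − d·(β·β))` — here `v(1 − d) = 1`
and the two terms `α²`, `dβ²` have values of opposite parity, so they never cancel: `v(α² − dβ²) = max ≥ v(α²)`.  Define-free reading of `Tr 𝔭_E^m ⊆ 𝔭_K^{⌊(m + 2e + 1)∕2⌋}`
for `E = K(√d)`, `f = 2e + 1` (`Tr(α + β√d) = 2α`). [cite: Serre1979, Ch. III §3 Prop. 7] [cite: Serre1979, Ch. V §3 Prop. 5 (iii)] -/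
theorem valued_mul_self_mul_one_sub_le_of_valued_lt_one {d : K} (hdv : Valued.v d < 1)
    (hdodd : ∀ y : K, Valued.v d ≠ Valued.v y * Valued.v y) (α β : K) :
    Valued.v (α * α * (1 - d)) ≤ Valued.v (α * α - d * (β * β)) := by
  rw [map_mul, Valuation.map_one_sub_of_lt _ hdv, mul_one]
  by_cases hβ : β = 0
  · rw [hβ, mul_zero, mul_zero, sub_zero]
  · have hvβ : Valued.v β ≠ 0 := (Valuation.ne_zero_iff _).2 hβ
    have hne : Valued.v (α * α) ≠ Valued.v (d * (β * β)) := by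
      intro h
      refine hdodd (α / β) ?_
      rw [map_mul, map_mul, map_mul] at h
      rw [map_div₀, div_mul_div_comm, eq_div_iff (mul_ne_zero hvβ hvβ)]
      exact h.symm
    rw [sub_eq_add_neg, Valuation.map_add_of_distinct_val _ (by rwa [Valuation.map_neg]), Valuation.map_neg]
    exact le_max_left _ _

/-- **TRACE BOUND, ODD DEFECT.**  If `v 4 < v(d − 1) ≤ 1` and `v(d − 1)` is not a square value (`d` a unit of odd quadratic defect `s < 2e`), then for all `α β`:
`v(α·α·(1 − d)) ≤ v(α·α − d·(β·β))`.  Write `α² − dβ² = (α − β)(α + β) − (d − 1)β²`; for `β ≠ 0` the two terms have DIFFERENT values — compare `v(2β)` with `v(α − β)`: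
if smaller, `v(α + β) = v(α − β)` and `v((α − β)(α + β))` is a square value; if larger, `v((α − β)(α + β)) = v(α − β)·v(2β) < v(4)·v(β)² < v(d − 1)·v(β)²`; if equal,
`v((α − β)(α + β)) ≤ v(2β)² < v(d − 1)·v(β)²` — so no cancellation, and `max ≥ v(α)²·v(d − 1)` in both sub-cases `v β ≥ v α` ∕ `v β < v α`.  Define-free reading of
`Tr 𝔭_E^m ⊆ 𝔭_K^{⌊(m + 2e + 1 − s)∕2⌋}` for `E = K(√d)`, `f = 2e + 1 − s`. [cite: Serre1979, Ch. III §3 Prop. 7] [cite: Omeara1963, §63A 63:2–63:5] -/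
theorem valued_mul_self_mul_one_sub_le_of_odd_defect {d : K} (h4d : Valued.v (4 : K) < Valued.v (d - 1)) (hd1 : Valued.v (d - 1) ≤ 1)
    (hsodd : ∀ y : K, Valued.v (d - 1) ≠ Valued.v y * Valued.v y) (α β : K) :
    Valued.v (α * α * (1 - d)) ≤ Valued.v (α * α - d * (β * β)) := by
  have h1d : Valued.v (1 - d) = Valued.v (d - 1) := by rw [← Valuation.map_neg, neg_sub]
  rw [map_mul, h1d, show α * α - d * (β * β) = (α - β) * (α + β) - (d - 1) * (β * β) by ring]
  by_cases hβ : β = 0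
  · rw [hβ, mul_zero, mul_zero, sub_zero, sub_zero, add_zero]
    exact mul_le_of_le_one_right' hd1
  have hvβ : Valued.v β ≠ 0 := (Valuation.ne_zero_iff _).2 hβ
  have hvβpos : 0 < Valued.v β := zero_lt_iff.2 hvβ
  -- the two terms never tie
  have hne : Valued.v ((α - β) * (α + β)) ≠ Valued.v ((d - 1) * (β * β)) := by
    intro htie
    rw [map_mul, map_mul, map_mul] at htie
    have hαβ : α + β = (α - β) + 2 * β := by ring
    rcases lt_trichotomy (Valued.v (2 * β)) (Valued.v (α - β)) with hlt | heq | hgt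
    · -- `v(2β) < v(α − β)`: `v(α + β) = v(α − β)`, a square value
      rw [hαβ, Valuation.map_add_eq_of_lt_left _ hlt] at htie
      refine hsodd ((α - β) / β) ?_
      rw [map_div₀, div_mul_div_comm, eq_div_iff (mul_ne_zero hvβ hvβ)]
      exact htie.symm
    · -- `v(2β) = v(α − β)`: `v(α + β) ≤ v(2β)`, so the product is `≤ v(2β)² = v 4 · v β² < v(d − 1) · v β²`
      have hle : Valued.v (α + β) ≤ Valued.v (2 * β) := by
        rw [hαβ]
        refine (Valuation.map_add _ _ _).trans ?_
        rw [heq, max_self]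
      have hlt' : Valued.v (α - β) * Valued.v (α + β) < Valued.v (d - 1) * (Valued.v β * Valued.v β) := by
        calc Valued.v (α - β) * Valued.v (α + β) ≤ Valued.v (2 * β) * Valued.v (2 * β) := by
              rw [← heq]
              exact mul_le_mul_right hle _
          _ = Valued.v (4 : K) * (Valued.v β * Valued.v β) := by rw [← map_mul, ← map_mul, ← map_mul]; ring_nf
          _ < Valued.v (d - 1) * (Valued.v β * Valued.v β) := mul_lt_mul_of_pos_right h4d (mul_pos hvβpos hvβpos)
      exact absurd htie hlt'.ne
    · -- `v(α − β) < v(2β)`: `v(α + β) = v(2β)`, product `< v(2β)² = v 4 · v β² < v(d − 1) · v β²`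
      rw [hαβ, Valuation.map_add_eq_of_lt_right _ hgt] at htie
      have h2β : Valued.v (2 * β) ≠ 0 := ne_of_gt (lt_of_le_of_lt zero_le hgt)
      have hlt' : Valued.v (α - β) * Valued.v (2 * β) < Valued.v (d - 1) * (Valued.v β * Valued.v β) := by
        calc Valued.v (α - β) * Valued.v (2 * β) < Valued.v (2 * β) * Valued.v (2 * β) := mul_lt_mul_of_pos_right hgt (zero_lt_iff.2 h2β)
          _ = Valued.v (4 : K) * (Valued.v β * Valued.v β) := by rw [← map_mul, ← map_mul, ← map_mul]; ring_nf
          _ < Valued.v (d - 1) * (Valued.v β * Valued.v β) := mul_lt_mul_of_pos_right h4d (mul_pos hvβpos hvβpos)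
      exact absurd htie hlt'.ne
  rw [show (α - β) * (α + β) - (d - 1) * (β * β) = (α - β) * (α + β) + -((d - 1) * (β * β)) from sub_eq_add_neg _ _,
    Valuation.map_add_of_distinct_val _ (by rwa [Valuation.map_neg]), Valuation.map_neg]
  rcases le_or_gt (Valued.v α) (Valued.v β) with hαβ | hβα
  · -- `v α ≤ v β`: the second term dominates what we need
    refine le_trans ?_ (le_max_right _ _)
    rw [map_mul, map_mul, map_mul, mul_comm]
    exact mul_le_mul_right (mul_le_mul' hαβ hαβ) _
  · -- `v β < v α`: `v(α ± β) = v α`, the first term is `v α²`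
    refine le_trans ?_ (le_max_left _ _)
    rw [map_mul, map_mul, Valuation.map_sub_eq_of_lt_left _ hβα, Valuation.map_add_eq_of_lt_left _ hβα]
    exact mul_le_of_le_one_right' hd1

/-! ## §3 The ladder for a general break `t`: `v 4 · exp t = v(1 − d)` -/

/-- **(L1) `U^{(n)} ⊆ N(U_E^{(2n − t)})` for `n ≥ t + 1`, with the EXACT depth.**  `K` with complete valuation ring, `d ≠ 1`, `v 4 · exp t = v(1 − d)`.  If `t + 1 ≤ n`
and `v(x − 1) ≤ exp(−n)` then `x = a·a − d·(b·b)` with depth `v((a−1)·(a−1) − d·(b·b)) = v(x − 1)² · exp t ≤ exp(−(2n − t))` — the universal witness of §1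
(`v((x − 1)(1 − d)) = v(x − 1)·v 4·exp t ≤ exp(t − n)·v 4 < v 4`).  Serre's `N(U_L^{ψ(n)}) ⊇ U_K^n`, `ψ(n) = 2n − t`, `n > t`.
[cite: Serre1979, Ch. V §3 Prop. 5 (iii), Cor. 3] [cite: NeukirchANT1999, Ch. V (1.2)–(1.3)] -/
theorem exists_sq_sub_mul_sq_eq_of_valued_sub_one_le_exp_neg [IsAdicComplete 𝓂[K] 𝒪[K]] {d : K} (hd1 : d ≠ 1) {t : ℕ}
    (ht : Valued.v (4 : K) * exp (t : ℤ) = Valued.v (1 - d)) {n : ℕ} (hn : t + 1 ≤ n) {x : K}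
    (hx : Valued.v (x - 1) ≤ exp (-(n : ℤ))) :
    ∃ a b : K, a * a - d * (b * b) = x ∧
      Valued.v ((a - 1) * (a - 1) - d * (b * b)) = Valued.v (x - 1) ^ 2 * exp (t : ℤ) ∧
      Valued.v ((a - 1) * (a - 1) - d * (b * b)) ≤ exp (-(2 * (n : ℤ) - t)) := by
  have h1d : (1 - d) ≠ 0 := sub_ne_zero.2 (Ne.symm hd1)
  have hv1d : Valued.v (1 - d) ≠ 0 := (Valuation.ne_zero_iff _).2 h1d
  have hv40 : Valued.v (4 : K) ≠ 0 := by
    intro h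
    rw [h, zero_mul] at ht
    exact hv1d ht.symm
  have hxlt : Valued.v ((x - 1) * (1 - d)) < Valued.v (4 : K) := by
    rw [map_mul, ← ht, mul_comm (Valued.v (4 : K)), ← mul_assoc]
    refine mul_lt_of_lt_one_left (zero_lt_iff.2 hv40) ?_
    calc Valued.v (x - 1) * exp (t : ℤ) ≤ exp (-(n : ℤ)) * exp (t : ℤ) := mul_le_mul_left hx _
      _ < 1 := by rw [← exp_add, ← exp_zero, exp_lt_exp]; omega
  obtain ⟨a, b, hN, hdepth⟩ := exists_sq_sub_mul_sq_eq_of_valued_mul_one_sub_lt_four hd1 hxlt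
  have hdepth' : Valued.v ((a - 1) * (a - 1) - d * (b * b)) = Valued.v (x - 1) ^ 2 * exp (t : ℤ) := by
    refine mul_right_cancel₀ hv40 ?_
    rw [hdepth, ← ht, mul_comm (Valued.v (4 : K)) _, mul_assoc]
  refine ⟨a, b, hN, hdepth', ?_⟩
  rw [hdepth']
  calc Valued.v (x - 1) ^ 2 * exp (t : ℤ) ≤ exp (-(n : ℤ)) ^ 2 * exp (t : ℤ) := mul_le_mul_left (pow_le_pow_left₀ zero_le hx 2) _
    _ = exp (-(2 * (n : ℤ) - t)) := by rw [pow_two, ← exp_add, ← exp_add]; congr 1; ring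

/-- **(L2)∕(L3) `N(U_E^{(m)}) ⊆ U^{(n)}` whenever `n ≤ m` and `2n ≤ m + t + 1`** — given the trace bound `hTB` (§2) and `v 4 · exp t = v(1 − d)`: if
`v((a−1)·(a−1) − d·(b·b)) ≤ exp(−m)` then `v(a·a − d·(b·b) − 1) ≤ exp(−n)`.  Indeed `N z − 1 = N(z − 1) + 2(a − 1)` and `v(2(a − 1))² = v 4·v((a − 1)²) ≤ exp(−(m + t))`
by `hTB`, so `v(2(a − 1)) ≤ exp(−n)` by rounding.  With `m = 2n − t` (`n ≥ t`): `N(U_E^{(ψ(n))}) ⊆ U^{(n)}`; with `m = 2n − t + 1` and `n + 1` in place of `n`: the SHARPNESS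
`N(U_E^{(ψ(n)+1)}) ⊆ U^{(n+1)}` (Serre V §3 Prop. 5 (iii), second clause). [cite: Serre1979, Ch. V §3 Prop. 5 (iii), Cor. 3] [cite: Serre1979, Ch. III §3 Prop. 7] -/
theorem valued_sq_sub_mul_sq_sub_one_le_exp_neg {d : K} {t : ℕ}
    (hTB : ∀ α β : K, Valued.v (α * α * (1 - d)) ≤ Valued.v (α * α - d * (β * β)))
    (ht : Valued.v (4 : K) * exp (t : ℤ) = Valued.v (1 - d)) {a b : K} {m n : ℤ}
    (hdepth : Valued.v ((a - 1) * (a - 1) - d * (b * b)) ≤ exp (-m)) (hnm : n ≤ m) (h2n : 2 * n ≤ m + t + 1) :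
    Valued.v (a * a - d * (b * b) - 1) ≤ exp (-n) := by
  have htr : Valued.v (2 * (a - 1)) ≤ exp (-n) := by
    refine le_exp_neg_of_sq_le_exp_neg (j := m + t) ?_ h2n
    have h1 : Valued.v ((a - 1) * (a - 1) * (1 - d)) ≤ exp (-m) := (hTB (a - 1) b).trans hdepth
    rw [map_mul, ← ht, ← mul_assoc] at h1
    have h2 : Valued.v (2 * (a - 1)) ^ 2 = Valued.v ((a - 1) * (a - 1)) * Valued.v (4 : K) := by
      rw [pow_two, ← map_mul, ← map_mul]
      congr 1
      ring
    rw [h2]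
    calc Valued.v ((a - 1) * (a - 1)) * Valued.v (4 : K) = Valued.v ((a - 1) * (a - 1)) * Valued.v (4 : K) * exp (t : ℤ) * exp (-(t : ℤ)) := by
          rw [mul_assoc _ (exp (t : ℤ)), ← exp_add, add_neg_cancel, exp_zero, mul_one]
      _ ≤ exp (-m) * exp (-(t : ℤ)) := mul_le_mul_left h1 _
      _ = exp (-(m + t)) := by rw [← exp_add]; congr 1; ring
  rw [show a * a - d * (b * b) - 1 = ((a - 1) * (a - 1) - d * (b * b)) + 2 * (a - 1) by ring]
  refine (Valuation.map_add _ _ _).trans (max_le (hdepth.trans ?_) htr)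
  rw [exp_le_exp]
  omega

/-! ## §4 The two ramified normal forms: `f = 2e + 1` (odd order) and `f = 2e + 1 − s` (odd defect `s`) -/

/-- **NORM LADDER, ODD ORDER** (`E = K(√d)`, `v d < 1` of odd order; `v 2 = exp(−e)`; break `t = 2e`, conductor `f = 2e + 1` = ★ `conductor_of_valued_odd`, `ψ(n) = 2n − 2e = 2n − f + 1`).
For `n ≥ 2e + 1`: (L1) every `x` with `v(x − 1) ≤ exp(−n)` is `a·a − d·(b·b)` with depth `≤ exp(−(2n − 2e))` (`U^{(n)} ⊆ N(U_E^{(ψ(n))})`); (L2) every representation of depth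
`≤ exp(−(2n − 2e))` has norm in `U^{(n)}`; (L3) every representation of depth `≤ exp(−(2n − 2e + 1))` has norm in `U^{(n+1)}` — so `N(U_E^{(2n − f + 1)}) = U^{(n)}` EXACTLY.
[cite: Serre1979, Ch. V §3 Prop. 5 (iii), Cor. 3] [cite: Serre1979, Ch. XV §2] [cite: NeukirchANT1999, Ch. V (1.2)–(1.3)] -/
theorem normLadder_of_valued_odd [IsAdicComplete 𝓂[K] 𝒪[K]] {e : ℕ} (he : Valued.v (2 : K) = exp (-(e : ℤ))) {d : K} (hdv : Valued.v d < 1)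
    (hdodd : ∀ y : K, Valued.v d ≠ Valued.v y * Valued.v y) {n : ℕ} (hn : 2 * e + 1 ≤ n) :
    (∀ x : K, Valued.v (x - 1) ≤ exp (-(n : ℤ)) →
        ∃ a b : K, a * a - d * (b * b) = x ∧ Valued.v ((a - 1) * (a - 1) - d * (b * b)) ≤ exp (-(2 * (n : ℤ) - 2 * e))) ∧
      (∀ a b : K, Valued.v ((a - 1) * (a - 1) - d * (b * b)) ≤ exp (-(2 * (n : ℤ) - 2 * e)) →
        Valued.v (a * a - d * (b * b) - 1) ≤ exp (-(n : ℤ))) ∧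
      (∀ a b : K, Valued.v ((a - 1) * (a - 1) - d * (b * b)) ≤ exp (-(2 * (n : ℤ) - 2 * e + 1)) →
        Valued.v (a * a - d * (b * b) - 1) ≤ exp (-((n : ℤ) + 1))) := by
  have hd1 : d ≠ 1 := by
    rintro rfl
    rw [map_one] at hdv
    exact lt_irrefl _ hdv
  have ht : Valued.v (4 : K) * exp ((2 * e : ℕ) : ℤ) = Valued.v (1 - d) := by
    rw [Valuation.map_one_sub_of_lt _ hdv, show (4 : K) = 2 * 2 by norm_num, map_mul, he, ← exp_add, ← exp_add, ← exp_zero]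
    congr 1
    push_cast
    ring
  have hTB := valued_mul_self_mul_one_sub_le_of_valued_lt_one hdv hdodd
  refine ⟨fun x hx => ?_, fun a b hab => ?_, fun a b hab => ?_⟩
  · obtain ⟨a, b, hN, -, hle⟩ := exists_sq_sub_mul_sq_eq_of_valued_sub_one_le_exp_neg hd1 ht (by omega) hx
    exact ⟨a, b, hN, by push_cast at hle; exact hle⟩
  · exact valued_sq_sub_mul_sq_sub_one_le_exp_neg hTB ht hab (by omega) (by push_cast; omega)
  · exact valued_sq_sub_mul_sq_sub_one_le_exp_neg hTB ht hab (by omega) (by push_cast; omega)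

/-- **NORM LADDER, ODD DEFECT** (`E = K(√d)`, `d` a unit with `v(d − 1) = exp(−s)`, `v 4 < v(d − 1)`, `s` odd — i.e. `v(d − 1)` not a square value; `v 2 = exp(−e)`; break
`t = 2e − s`, conductor `f = 2e + 1 − s` = ★ `conductor_one_add_of_odd_defect`, `ψ(n) = 2n − 2e + s = 2n − f + 1`).  For `n ≥ 2e + 1 − s`: (L1) every `x` with `v(x − 1) ≤ exp(−n)`
is `a·a − d·(b·b)` with depth `≤ exp(−(2n − 2e + s))`; (L2) every representation of depth `≤ exp(−(2n − 2e + s))` has norm in `U^{(n)}`; (L3) every representation of depth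
`≤ exp(−(2n − 2e + s + 1))` has norm in `U^{(n+1)}` — `N(U_E^{(2n − f + 1)}) = U^{(n)}` EXACTLY.
[cite: Serre1979, Ch. V §3 Prop. 5 (iii), Cor. 3] [cite: Serre1979, Ch. XV §2] [cite: Omeara1963, §63B 63:11a] -/
theorem normLadder_of_odd_defect [IsAdicComplete 𝓂[K] 𝒪[K]] {e : ℕ} (he : Valued.v (2 : K) = exp (-(e : ℤ))) {d : K} {s : ℕ}
    (hs : Valued.v (d - 1) = exp (-(s : ℤ))) (h4d : Valued.v (4 : K) < Valued.v (d - 1))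
    (hsodd : ∀ y : K, Valued.v (d - 1) ≠ Valued.v y * Valued.v y) {n : ℕ} (hn : 2 * e + 1 ≤ n + s) :
    (∀ x : K, Valued.v (x - 1) ≤ exp (-(n : ℤ)) →
        ∃ a b : K, a * a - d * (b * b) = x ∧ Valued.v ((a - 1) * (a - 1) - d * (b * b)) ≤ exp (-(2 * (n : ℤ) - 2 * e + s))) ∧
      (∀ a b : K, Valued.v ((a - 1) * (a - 1) - d * (b * b)) ≤ exp (-(2 * (n : ℤ) - 2 * e + s)) →
        Valued.v (a * a - d * (b * b) - 1) ≤ exp (-(n : ℤ))) ∧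
      (∀ a b : K, Valued.v ((a - 1) * (a - 1) - d * (b * b)) ≤ exp (-(2 * (n : ℤ) - 2 * e + s + 1)) →
        Valued.v (a * a - d * (b * b) - 1) ≤ exp (-((n : ℤ) + 1))) := by
  have hv4 : Valued.v (4 : K) = exp (-(2 * (e : ℤ))) := by
    rw [show (4 : K) = 2 * 2 by norm_num, map_mul, he, ← exp_add]
    congr 1
    ring
  have hs2e : s < 2 * e := by
    have h := h4d
    rw [hv4, hs, exp_lt_exp] at h
    omega
  have hd1 : d ≠ 1 := by
    rintro rfl
    rw [sub_self, map_zero] at hs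
    exact exp_ne_zero hs.symm
  have h1d : Valued.v (1 - d) = Valued.v (d - 1) := by rw [← Valuation.map_neg, neg_sub]
  have ht : Valued.v (4 : K) * exp ((2 * e - s : ℕ) : ℤ) = Valued.v (1 - d) := by
    rw [h1d, hs, hv4, ← exp_add]
    congr 1
    push_cast [hs2e.le]
    ring
  have hTB := valued_mul_self_mul_one_sub_le_of_odd_defect h4d (by rw [hs, ← exp_zero, exp_le_exp]; omega) hsodd
  refine ⟨fun x hx => ?_, fun a b hab => ?_, fun a b hab => ?_⟩
  · obtain ⟨a, b, hN, -, hle⟩ := exists_sq_sub_mul_sq_eq_of_valued_sub_one_le_exp_neg hd1 ht (by omega) hx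
    refine ⟨a, b, hN, ?_⟩
    push_cast [hs2e.le] at hle
    convert hle using 2
    congr 1
    ring
  · exact valued_sq_sub_mul_sq_sub_one_le_exp_neg hTB ht hab (by omega) (by push_cast [hs2e.le]; omega)
  · exact valued_sq_sub_mul_sq_sub_one_le_exp_neg hTB ht hab (by omega) (by push_cast [hs2e.le]; omega)

end Ladder

end Literature.NumberTheory.LocalFields
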